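import Summits.NavierStokesRegularity.NavierStokesRegularity.Theses.CertifiedBlowup
import Literature.Analysis.FluidPDE.VorticityBlowupMaximal
import Literature.Analysis.FluidPDE.LerayHopfFinalWeakSlice
import HarnessLib.Audit

/-!
# Birth skeleton (BC3) of the crux `CertifiedBlowup.CertifiedBlowupAxisymBlowup` (X5a_axi)

(crux item `stmt-NavierStokesRegularity-0727`, ledger name `certifiedBlowup_axisym_blowup`, rank 2 of route
`route-NavierStokesRegularity-CertifiedBlowup` — NEGATIVE route, `closes hX hU : ¬ NavierStokesRegularity`,
X5b `BlowupClayUniqueness` already PROVED; the item is shared (rank 4) with routes `DimensionLadder` and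
`SwirlThreshold`, whose copies are `Iff.rfl`-identical (refuter crux-attack rattack-0727, 2026-08-17). Tree
path `Cruxes/CertifiedBlowupAxisymBlowup/Lines/birth.lean`; registrar
`planner-skel-stmt-NavierStokesRegularity-0727-0`, 2026-08-17, route re-audit bin HONEST. At registration
time `ledger crux ls stmt-NavierStokesRegularity-0727` showed NO workfiles: no `Disproof.lean`, no `Lines/`,
no crux ideas, no dead lines, no `Negative/` lemmas; the negatives index of the summit (4 refuted statements:
stmt-4055, 1832, 1429, 0154) contains nothing about maximal developments or rescaled vorticity floors.)

THE CRUX (by name, never restated). `CertifiedBlowupAxisymBlowup` = X5a_axi: for some `ν > 0` and some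
finite `T > 0` there is a classical solution `(u, p)` of unforced Navier–Stokes on `ℝ³ × [0, T)` which is a
MAXIMAL smooth solution with lifespan `T` (`IsMaximalSmoothSolution ν 0 u p T`), Leray–Hopf on the closed
slab `[0, T]` from its own datum (`IsLerayHopfOn T ν 0 (u 0) u`), the datum being rapidly decaying
(Fefferman (4)) AND axisymmetric. Refuter record: open as stated, `= ¬ ns.S25 (AxisymmetricSwirlRegularity)
modulo local well-posedness`, no junk witness (the Leray–Hopf conjunct on the CLOSED slab is load-bearing:
without it the parasitic pressure-driven flow proves the statement, `Mutation.lean` on the item).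

THE CUT — along the seam of the route's own METHOD (Route header, WHY THIS LINE / TWO-LAYER PLAN: a
Chen–Hou-type computer-assisted proof of nearly self-similar blow-up in DYNAMIC-RESCALING variables,
`ω̃(ξ, τ) = C_ω(τ) ω(C_l(τ) ξ, t(τ))`, `t(τ) = ∫₀^τ C_ω`, `T = t(∞) = blowupTime C_ω`; ChenHou2022 =
arXiv:2210.07191 §6.5, ChenHou2021Boundary §4.1, Hou2022PotentiallySingularNS = arXiv:2107.06509 for the
interior NS scenario). A nonlinear-stability theorem of that kind is an A PRIORI statement — "for as long as
the (energy-class) solution from the certified datum exists, its rescaled vorticity keeps a floor on the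
core region" — and blow-up EXISTENCE then follows from the maximal development of the datum. Exactly these
two pieces are the stubs; everything downstream of them is ALREADY PROVED in the tree and is used, by name,
in the composition:
`Literature.Analysis.FluidPDE.isMaximalSmoothSolution_of_rescaling` (VorticityBlowupMaximal.lean: rescaled
floor on a bounded region ⇒ `VorticityBlowsUpOnAt Ω u (blowupTime C)` ⇒ no classical continuation ⇒
maximal), `Literature.Analysis.FluidPDE.exists_isLerayHopfOn_update_of_forall_lt`
(LerayHopfFinalWeakSlice.lean: Leray–Hopf on every `[0, T')`, `T' < T` ⇒ Leray–Hopf on `[0, T]` after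
`u T :=` the weak `L²` limit; Leray 1934 §31–33, Galdi 2000 Lemma 2.2).

* `stub_maximalDevelopment` [KNOWN, size L/XL to formalise — the maximal smooth development of a Clay datum
  in the energy class]: for `ν > 0` and a smooth, divergence-free, rapidly decaying datum `u₀`, EITHER there
  is a GLOBAL classical solution `(u, p)` on `ℝ³ × [0, ∞)` with `u 0 = u₀` which is Leray–Hopf on every
  `[0, T]`, OR there are a finite `T > 0` and a MAXIMAL smooth solution `(u, p)` on `[0, T)` with `u 0 = u₀`
  which is Leray–Hopf on every closed sub-slab `[0, T']`, `T' < T`. Content: local existence of the smooth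
  solution for `H^∞` data (Leray 1934 §19 "solutions régulières"; Fujita–Kato 1964 Thm 1.1; Majda–Bertozzi
  2002 Thm 3.4 with the `C^∞` bootstrap; in tree only as the NAMED FACT
  `Literature.Analysis.FluidPDE.local_classical_lerayHopf`, short time), uniqueness and continuation to the
  maximal interval (KNSS 2009 §4 restart step; gluing lemma
  `IsClassicalNSSolutionOn.exists_glue_Ico_right` in tree), and the energy equality of smooth finite-energy
  solutions on compact sub-slabs (Robinson–Rodrigo–Sadowski 2016 Thm 4.6; the Schwartz-class solution is in
  `C([0,T']; H^k)` for all `k`). Why it might fail: it should not (textbook); the risk is the size of the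
  formalisation (joint `C^∞` up to `t = 0` with one-sided time derivatives, Leray–Hopf fields on the closed
  sub-slabs). Deliberately the finite branch asserts Leray–Hopf only BEFORE `T`: the slice at `T` is supplied
  by the proved final-weak-slice theorem in the composition.
* `stub_rescaledVorticityFloor` [OPEN, size XL — THE HEART: the a-priori output of a constant-viscosity
  Chen–Hou-type certificate]: there are `ν > 0`, a smooth divergence-free rapidly decaying AXISYMMETRIC datum
  `u₀`, a continuous positive vorticity-rescaling factor `C = C_ω` integrable on `(0, ∞)` (so the physical
  time `t(τ) = rescaledTime C τ` increases to the finite `blowupTime C`), a BOUNDED core region `Ω` and a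
  floor `m > 0`, such that EVERY classical solution `(v, q)` on any slab `[0, T')` from `u₀` which is
  Leray–Hopf on the closed sub-slabs obeys, for all rescaled times `τ ≥ 0` with `t(τ) < T'`:
  `∃ x ∈ Ω, m ≤ C(τ) ‖curl v(t(τ), x)‖` — the rescaled vorticity keeps the floor `m` on the core for as
  long as the solution lives. (By weak–strong uniqueness in the Leray–Hopf class — Prodi 1959 / Serrin 1963,
  the smooth decaying solution being bounded on compact sub-slabs — the universally quantified class is the
  single physical solution from `u₀` and its restrictions, so this is precisely "the certified solution stays
  in the bootstrap regime, where `‖ω̃(τ)‖_{L^∞(core)} ≥ m`", ChenHou2021Boundary §4.1 p. 11, ChenHou2022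
  §6.5 p. 66, written a priori.) Why it might fail: exactly as the crux — NS may be regular for axisymmetric
  data (`AxisymmetricSwirlRegularity`, ns.S25); every printed certificate stops short of constant-`ν` NS on
  `ℝ³` (ChenHou2022/2025: Euler WITH boundary; Elgindi2021: `C^{1,α}`; Hou2022's fitted growth sits at the
  KNSS-forbidden endpoint `β = 1/2`; Hou2026 = doi:10.1007/s10208-026-09748-8 changes the equation); and the
  route's own rate dichotomy (#3/#4: a bounded-profile certificate is vorticity-Type-I, `β = c_l/|c_ω| ∈
  [2/5, 1/2)`, asymptotically inviscid, seen by Seregin's Euler scaling as a swirl-free Euler limit —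
  Seregin2024AxisymTypeII = arXiv:2402.13229, Seregin2026) may empty the certificate class. Sources:
  arXiv:2210.07191, arXiv:2107.06509, arXiv:2305.05660, KochNadirashviliSereginSverak2009, Prodi1959,
  Serrin1963.

COMPOSITION. `certifiedBlowup_axisym_blowup_of : S₁ → S₂ → <the item's signature verbatim>` is the real
proof (no placeholder anywhere; standard axioms): take the certified datum `u₀` of S₂ and its maximal
development (S₁). The GLOBAL branch is impossible: restricted to `[0, blowupTime C)` the global solution is in
the class of S₂, so the floor holds for all `τ ≥ 0`, whence `isMaximalSmoothSolution_of_rescaling` makes the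
restriction maximal at `blowupTime C` — but the global solution itself continues it
(`IsClassicalNSSolutionOn.hasSmoothExtensionPast`). The FINITE branch is the witness after closing the energy
class at the blow-up time: `exists_isLerayHopfOn_update_of_forall_lt` redefines `u T` as the weak `L²` limit,
and maximality / the classical equations transfer because they only see the slices on `[0, T)`
(`isClassicalNSSolutionOn_congr_velocity`, the in-file twin of the tree lemma
`IsClassicalNSSolutionOn.congr_velocity` of NSLerayStrongLocalExistence.lean, kept inline to keep the import
cone at two proof files). `CertifiedBlowupAxisymBlowup_of : Theses.CertifiedBlowup.CertifiedBlowupAxisymBlowup`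
— the ONLY theorem of this file concluding the crux, BY NAME, no `Prop` hypotheses — applies it to the two
stubs by name; placeholders occur ONLY inside the two `stub_*`. The registrar's folder evidence
`bc/CertifiedBlowupAxisymBlowup_birth_closed.lean` is this file with the two stubs deleted (the closed
composition alone, axioms `propext`, `Classical.choice`, `Quot.sound`).

HONEST ACCOUNTING. S₂ carries the whole open difficulty of the crux (as it must: X5a_axi is an open
blow-up conjecture); S₁ is known mathematics absent from the tree. Neither is the crux or the summit in
costume: `S₂ → crux` needs S₁ (no classical solution is produced by S₂), `crux → S₂` is false in general (a
blow-up need not carry a rescaling floor), `S₁` is a true theorem about ALL Clay data, and no stub speaks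
about Clay (A) itself — `Sᵢ → NavierStokesRegularity` and `Sᵢ → ¬ NavierStokesRegularity` need,
respectively, nothing less than the summit and the Clay-class uniqueness/LH-membership of Fefferman's
solutions. JUNK AUDIT of S₂: the floor is demanded only at `τ ≥ 0` with `t(τ) < T'` (the solution is read
inside its domain; `T' ≤ 0` makes the clause vacuous since `t(τ) ≥ 0`); `m > 0`, `C > 0` continuous
integrable and `Ω` bounded are explicit; a vacuous discharge (empty solution class for the chosen `u₀`)
would require proving NON-existence of local classical Leray–Hopf solutions from a smooth decaying datum —
false (Leray 1934), hence unavailable; the Galilean / pressure-driven parasitic solutions from the same datum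
(`v = u(· − b(t)) + b'(t)`, which would translate the core out of `Ω`) are excluded by the Leray–Hopf
hypothesis on `v`, as on the crux itself.

BC3 PROBES (registrar folder `bc/probe_*.lean`, importing the route file + the FluidPDE modules above but
NOT this file): for each stub statement `S`, `S → CertifiedBlowupAxisymBlowup`, `S → NavierStokesRegularity`
and `S → ¬ NavierStokesRegularity` by `first | exact? | simpa | aesop` must FAIL; results and the recorded
converses are quoted in `Lines/birth.md`.
-/

noncomputable section

open Set Filter Function MeasureTheory Bornology
open Literature.Analysis.FluidPDE

namespace Summit.NavierStokesRegularity.NavierStokesRegularity.Cruxes.CertifiedBlowupAxisymBlowup.Birth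

set_option linter.unusedVariables false
set_option linter.dupNamespace false

/-- **stub 1 — `stub_maximalDevelopment` (KNOWN; the maximal smooth development of a Clay datum in the
energy class).** For `ν > 0` and a smooth, divergence-free, rapidly decaying datum `u₀ : ℝ³ → ℝ³`: EITHER a
global classical solution `(u, p)` of unforced NS_ν on `ℝ³ × [0, ∞)` with `u 0 = u₀`, Leray–Hopf on every
`[0, T]`, `T > 0`; OR a finite `T > 0` and a maximal smooth solution `(u, p)` on `[0, T)` with `u 0 = u₀`,
Leray–Hopf on every `[0, T']`, `0 < T' < T`. (Leray 1934 §19 + §§15–17; Fujita–Kato 1964 Thm 1.1;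
Majda–Bertozzi 2002 Thm 3.4; KNSS 2009 §4; Robinson–Rodrigo–Sadowski 2016 Thm 4.6; tree:
`local_classical_lerayHopf` (named fact, short time), `IsClassicalNSSolutionOn.exists_glue_Ico_right`.) -/
theorem stub_maximalDevelopment :
    ∀ ν : ℝ, 0 < ν → ∀ u₀ : EuclideanSpace ℝ (Fin 3) → EuclideanSpace ℝ (Fin 3),
      ContDiff ℝ (⊤ : ℕ∞) u₀ → Literature.Analysis.FluidPDE.NSWave0.IsDivFree u₀ →
      Literature.Analysis.FluidPDE.HasRapidSpatialDecay u₀ →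
      (∃ (u : ℝ → EuclideanSpace ℝ (Fin 3) → EuclideanSpace ℝ (Fin 3))
          (p : ℝ → EuclideanSpace ℝ (Fin 3) → ℝ),
          Literature.Analysis.FluidPDE.IsClassicalNSSolutionOn (Set.Ici 0) ν 0 u p ∧ u 0 = u₀ ∧
          ∀ T : ℝ, 0 < T → Literature.Analysis.FluidPDE.IsLerayHopfOn T ν 0 u₀ u) ∨
      (∃ T : ℝ, 0 < T ∧ ∃ (u : ℝ → EuclideanSpace ℝ (Fin 3) → EuclideanSpace ℝ (Fin 3))
          (p : ℝ → EuclideanSpace ℝ (Fin 3) → ℝ),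
          Literature.Analysis.FluidPDE.IsMaximalSmoothSolution ν 0 u p T ∧ u 0 = u₀ ∧
          ∀ T' ∈ Set.Ioo 0 T, Literature.Analysis.FluidPDE.IsLerayHopfOn T' ν 0 u₀ u) := by
  sorry

/-- **stub 2 — `stub_rescaledVorticityFloor` (OPEN — THE HEART: the a-priori output of a constant-viscosity
Chen–Hou-type dynamic-rescaling certificate).** There are `ν > 0`, a smooth divergence-free rapidly decaying
AXISYMMETRIC datum `u₀`, a continuous positive vorticity-rescaling factor `C = C_ω` integrable on `(0, ∞)`
(finite `blowupTime C = t(∞)`), a bounded core region `Ω ⊆ ℝ³` and `m > 0` such that every classical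
solution `(v, q)` of unforced NS_ν on a slab `[0, T')`, `T' > 0`, with `v 0 = u₀`, Leray–Hopf on every
`[0, T'']`, `0 < T'' < T'`, satisfies `∃ x ∈ Ω, m ≤ C τ · ‖curl (v (t τ)) x‖` for every `τ ≥ 0` with
`t τ = rescaledTime C τ < T'`. (ChenHou2021Boundary §4.1 p. 11; ChenHou2022 = arXiv:2210.07191 §6.5 p. 66;
Hou2022 = arXiv:2107.06509; a priori by Prodi–Serrin weak–strong uniqueness.) -/
theorem stub_rescaledVorticityFloor :
    ∃ ν : ℝ, 0 < ν ∧ ∃ u₀ : EuclideanSpace ℝ (Fin 3) → EuclideanSpace ℝ (Fin 3),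
      ContDiff ℝ (⊤ : ℕ∞) u₀ ∧ Literature.Analysis.FluidPDE.NSWave0.IsDivFree u₀ ∧
      Literature.Analysis.FluidPDE.HasRapidSpatialDecay u₀ ∧
      Literature.Analysis.FluidPDE.IsAxisymmetric u₀ ∧
      ∃ C : ℝ → ℝ, Continuous C ∧ (∀ τ : ℝ, 0 < C τ) ∧ MeasureTheory.IntegrableOn C (Set.Ioi 0) ∧
      ∃ Ω : Set (EuclideanSpace ℝ (Fin 3)), Bornology.IsBounded Ω ∧ ∃ m : ℝ, 0 < m ∧
      ∀ (T' : ℝ) (v : ℝ → EuclideanSpace ℝ (Fin 3) → EuclideanSpace ℝ (Fin 3))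
        (q : ℝ → EuclideanSpace ℝ (Fin 3) → ℝ), 0 < T' →
        Literature.Analysis.FluidPDE.IsClassicalNSSolutionOn (Set.Ico 0 T') ν 0 v q → v 0 = u₀ →
        (∀ T'' ∈ Set.Ioo 0 T', Literature.Analysis.FluidPDE.IsLerayHopfOn T'' ν 0 u₀ v) →
        ∀ τ : ℝ, 0 ≤ τ → Literature.Analysis.FluidPDE.rescaledTime C τ < T' →
          ∃ x ∈ Ω, m ≤ C τ *
            ‖Literature.Analysis.FluidPDE.curl (v (Literature.Analysis.FluidPDE.rescaledTime C τ)) x‖ := by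
  sorry

/-- Assembly glue (PROVED): a classical solution stays classical when the velocity is modified at times
outside the time set `S` — every clause of `IsClassicalNSSolutionOn` only sees the slices `u t`, `t ∈ S`,
and the time derivative WITHIN `S`. In-file twin of `IsClassicalNSSolutionOn.congr_velocity`
(NSLerayStrongLocalExistence.lean), kept here to keep the import cone small. [folklore] -/
theorem isClassicalNSSolutionOn_congr_velocity {E : Type*} [NormedAddCommGroup E]
    [InnerProductSpace ℝ E] [FiniteDimensional ℝ E] {S : Set ℝ} {ν : ℝ} {f u v : ℝ → E → E}
    {p : ℝ → E → ℝ} (h : IsClassicalNSSolutionOn S ν f u p) (huv : ∀ t ∈ S, v t = u t) :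
    IsClassicalNSSolutionOn S ν f v p where
  smooth_velocity :=
    h.smooth_velocity.congr fun z hz => by
      change v z.1 z.2 = u z.1 z.2
      rw [huv z.1 (mem_prod.1 hz).1]
  smooth_pressure := h.smooth_pressure
  momentum t ht x := by
    have h1 : timeDerivWithin S v t x = timeDerivWithin S u t x := by
      simp only [timeDerivWithin]
      exact derivWithin_congr (fun s hs => by rw [huv s hs]) (by rw [huv t ht])
    rw [h1, huv t ht]
    exact h.momentum t ht x
  divFree t ht := by
    rw [huv t ht]
    exact h.divFree t ht

/-- **The closed composition (real proof, no placeholder): the two stub statements, verbatim, imply the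
item's signature verbatim** (`certifiedBlowup_axisym_blowup` = stmt-NavierStokesRegularity-0727). Take the
certified datum `u₀` of the floor and its maximal development. GLOBAL branch: restricted to
`[0, blowupTime C)` the global solution lies in the floor's class, so the floor holds for all `τ ≥ 0`, and
`isMaximalSmoothSolution_of_rescaling` makes the restriction maximal at `blowupTime C` — contradicted by the
global solution continuing it. FINITE branch: close the energy class at `T` by the weak final slice
(`exists_isLerayHopfOn_update_of_forall_lt`) and transfer the classical equations / maximality, which only
see `[0, T)`. -/
theorem certifiedBlowup_axisym_blowup_of
    (hdev : ∀ ν : ℝ, 0 < ν → ∀ u₀ : EuclideanSpace ℝ (Fin 3) → EuclideanSpace ℝ (Fin 3),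
      ContDiff ℝ (⊤ : ℕ∞) u₀ → Literature.Analysis.FluidPDE.NSWave0.IsDivFree u₀ →
      Literature.Analysis.FluidPDE.HasRapidSpatialDecay u₀ →
      (∃ (u : ℝ → EuclideanSpace ℝ (Fin 3) → EuclideanSpace ℝ (Fin 3))
          (p : ℝ → EuclideanSpace ℝ (Fin 3) → ℝ),
          Literature.Analysis.FluidPDE.IsClassicalNSSolutionOn (Set.Ici 0) ν 0 u p ∧ u 0 = u₀ ∧
          ∀ T : ℝ, 0 < T → Literature.Analysis.FluidPDE.IsLerayHopfOn T ν 0 u₀ u) ∨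
      (∃ T : ℝ, 0 < T ∧ ∃ (u : ℝ → EuclideanSpace ℝ (Fin 3) → EuclideanSpace ℝ (Fin 3))
          (p : ℝ → EuclideanSpace ℝ (Fin 3) → ℝ),
          Literature.Analysis.FluidPDE.IsMaximalSmoothSolution ν 0 u p T ∧ u 0 = u₀ ∧
          ∀ T' ∈ Set.Ioo 0 T, Literature.Analysis.FluidPDE.IsLerayHopfOn T' ν 0 u₀ u))
    (hfloor : ∃ ν : ℝ, 0 < ν ∧ ∃ u₀ : EuclideanSpace ℝ (Fin 3) → EuclideanSpace ℝ (Fin 3),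
      ContDiff ℝ (⊤ : ℕ∞) u₀ ∧ Literature.Analysis.FluidPDE.NSWave0.IsDivFree u₀ ∧
      Literature.Analysis.FluidPDE.HasRapidSpatialDecay u₀ ∧
      Literature.Analysis.FluidPDE.IsAxisymmetric u₀ ∧
      ∃ C : ℝ → ℝ, Continuous C ∧ (∀ τ : ℝ, 0 < C τ) ∧ MeasureTheory.IntegrableOn C (Set.Ioi 0) ∧
      ∃ Ω : Set (EuclideanSpace ℝ (Fin 3)), Bornology.IsBounded Ω ∧ ∃ m : ℝ, 0 < m ∧
      ∀ (T' : ℝ) (v : ℝ → EuclideanSpace ℝ (Fin 3) → EuclideanSpace ℝ (Fin 3))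
        (q : ℝ → EuclideanSpace ℝ (Fin 3) → ℝ), 0 < T' →
        Literature.Analysis.FluidPDE.IsClassicalNSSolutionOn (Set.Ico 0 T') ν 0 v q → v 0 = u₀ →
        (∀ T'' ∈ Set.Ioo 0 T', Literature.Analysis.FluidPDE.IsLerayHopfOn T'' ν 0 u₀ v) →
        ∀ τ : ℝ, 0 ≤ τ → Literature.Analysis.FluidPDE.rescaledTime C τ < T' →
          ∃ x ∈ Ω, m ≤ C τ *
            ‖Literature.Analysis.FluidPDE.curl (v (Literature.Analysis.FluidPDE.rescaledTime C τ)) x‖) :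
    ∃ ν : ℝ, 0 < ν ∧ ∃ T : ℝ, 0 < T ∧
      ∃ (u : ℝ → EuclideanSpace ℝ (Fin 3) → EuclideanSpace ℝ (Fin 3))
        (p : ℝ → EuclideanSpace ℝ (Fin 3) → ℝ),
        Literature.Analysis.FluidPDE.IsMaximalSmoothSolution ν 0 u p T ∧
        Literature.Analysis.FluidPDE.IsLerayHopfOn T ν 0 (u 0) u ∧
        Literature.Analysis.FluidPDE.HasRapidSpatialDecay (u 0) ∧
        Literature.Analysis.FluidPDE.IsAxisymmetric (u 0) := by
  obtain ⟨ν, hν, u₀, hs, hdiv, hdec, haxi, C, hC, hpos, hint, Ω, hΩ, m, hm, hfl⟩ := hfloor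
  rcases hdev ν hν u₀ hs hdiv hdec with ⟨u, p, hcl, h0, hLH⟩ | ⟨T, hT, u, p, hmax, h0, hLH⟩
  · -- GLOBAL branch: excluded by the floor (rescaling ⇒ maximal at `blowupTime C`, yet continued)
    exfalso
    have hTpos : 0 < blowupTime C := blowupTime_pos hC hpos hint
    have hclT : IsClassicalNSSolutionOn (Ico 0 (blowupTime C)) ν 0 u p :=
      hcl.mono Ico_subset_Ici_self (uniqueDiffOn_Ico 0 (blowupTime C))
    have hlow : ∀ᶠ τ in atTop, ∃ x ∈ Ω, m ≤ C τ * ‖curl (u (rescaledTime C τ)) x‖ :=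
      eventually_atTop.2 ⟨0, fun τ hτ => hfl (blowupTime C) u p hTpos hclT h0
        (fun T'' hT'' => hLH T'' hT''.1) τ hτ (rescaledTime_lt_blowupTime hC hpos hint τ)⟩
    have hmaxT : IsMaximalSmoothSolution ν 0 u p (blowupTime C) :=
      isMaximalSmoothSolution_of_rescaling hC hpos hint hΩ hm hlow hclT
    exact hmaxT.2 ((hcl.mono Ico_subset_Ici_self (uniqueDiffOn_Ico 0 (blowupTime C + 1))
      ).hasSmoothExtensionPast (lt_add_one _))
  · -- FINITE branch: the witness, after closing the energy class at the blow-up time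
    obtain ⟨Y, -, hLHT⟩ := exists_isLerayHopfOn_update_of_forall_lt hT hν hLH
    have hU0 : Function.update u T Y 0 = u₀ := by
      rw [Function.update_of_ne hT.ne Y u, h0]
    have hagreeU : ∀ t ∈ Ico 0 T, Function.update u T Y t = u t := fun t ht =>
      Function.update_of_ne (ne_of_lt ht.2) Y u
    refine ⟨ν, hν, T, hT, Function.update u T Y, p, ⟨?_, ?_⟩, ?_, ?_, ?_⟩
    · exact isClassicalNSSolutionOn_congr_velocity hmax.1 hagreeU
    · rintro ⟨T₁, hT₁, u', p', hcl', hagree⟩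
      exact hmax.2 ⟨T₁, hT₁, u', p', hcl', fun t ht => (hagree t ht).trans (hagreeU t ht)⟩
    · rw [hU0]
      exact hLHT
    · rw [hU0]
      exact hdec
    · rw [hU0]
      exact haxi

/-- **Birth composition (the skeleton theorem): the crux BY NAME from the two registered stubs, used by
name; the ONLY theorem of this file concluding the crux; no `Prop` hypotheses.** Placeholders: exactly the two
`stub_*` (through this term); the mathematics is `certifiedBlowup_axisym_blowup_of` above. -/
theorem CertifiedBlowupAxisymBlowup_of :
    Summit.NavierStokesRegularity.NavierStokesRegularity.Theses.CertifiedBlowup.CertifiedBlowupAxisymBlowup :=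
  certifiedBlowup_axisym_blowup_of stub_maximalDevelopment stub_rescaledVorticityFloor

end Summit.NavierStokesRegularity.NavierStokesRegularity.Cruxes.CertifiedBlowupAxisymBlowup.Birth

end
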